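import Literature.AlgebraicGeometry.Frobenioids.EquivalenceFrobeniusType
import HarnessLib

/-!
# Frobenioids I, §3: Theorem 3.4 (iii), claim (F3) — equivalences preserve Frobenius degrees
# (isotropic type, bases of FSM-type, non-dilating divisor monoids, non-group-like type)

Mochizuki, *The geometry of Frobenioids I: the general theory*, Kyushu J. Math. **62** (2008),
Thm. 3.4 (iii), proof, claim (F3), kurims p. 65: "it suffices to show that if `ζ₁, θ₁ ∈ End(A₁)` are
prime-Frobenius base-identity endomorphisms such that `deg_Fr(ζ₁) < deg_Fr(θ₁)`, then
`deg_Fr(ζ₂) < deg_Fr(θ₂)` … the condition '`deg_Fr(ζ₁) < deg_Fr(θ₁)`' is equivalent to … `β_{θ₁} =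
γ₁ ∘ β_{ζ₁}`, for some step `γ₁`" [cite: MochizukiFrdI2008, Thm. 3.4 (iii) p.65].

PROOF-ONLY (seat abc-iut-L1-t13; the cell's repair programme over bases of FSM-type). For the steps `β`
of the squares `α ≫ ψ = φ ≫ α ≫ β` of Prop. 1.14 (v) one has `α^* Div(β) · Div(α) = Div(α)^{deg φ}`
(`FrdI.pull_div_mul_of_square`); hence `deg ζ ≤ deg θ` forces `β_θ` to factor through `β_ζ` (Def. 1.3
(iii)(d)), a condition `Ψ` transports, and the same identity in `C₂` returns `deg Ψζ ≤ deg Ψθ`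
(`FrdI.degFr_map_le`). With the consistency of degrees (`FrdI.degFr_map_eq_of_degFr_eq`) for `Ψ` and
`Ψ⁻¹` this yields `Ψ^{ℕ≥1} = id`: `FrdI.degFr_map_of_isPrimeFrobenius` — for Frobenioids of isotropic type
over bases of FSM-type with non-dilating divisor monoids and non-group-like objects on both sides, `Ψ`
preserves the Frobenius degree of prime-Frobenius morphisms. No statement of the paper is restated.
-/

set_option backward.isDefEq.respectTransparency false

namespace Literature.AlgebraicGeometry.Frobenioids

open CategoryTheory Opposite

universe w v v' u u'

/-- In a sharp cancellative monoid, `x ^ q = x ^ p * c` with `x ≠ 1` forces `p ≤ q`.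
[cite: MochizukiFrdI2008, §0 p.11] -/
theorem le_of_pow_eq_pow_mul {M : Type w} [CommMonoid M] [IsCancelMul M] (hS : IsSharp M) {x c : M}
    (hx : x ≠ 1) {p q : ℕ} (h : x ^ q = x ^ p * c) : p ≤ q := by
  by_contra hlt
  rw [not_le] at hlt
  have h1 : x ^ q * 1 = x ^ q * (x ^ (p - q) * c) := by
    rw [mul_one, ← mul_assoc, ← pow_add, Nat.add_sub_cancel' hlt.le, ← h]
  have h2 : x ^ (p - q) * c = 1 := (mul_left_cancel h1).symm
  have hu : IsUnit (x ^ (p - q)) := IsUnit.of_mul_eq_one c h2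
  exact hx (hS.eq_one_of_isUnit x (IsUnit.of_pow_eq_one
    (hS.eq_one_of_isUnit _ hu) (Nat.sub_ne_zero_of_lt hlt)))

namespace FrdI

section One

variable {D : Type u} [Category.{v} D] {Φ : Dᵒᵖ ⥤ CommMonCat.{w}} {C : Type u'} [Category.{v'} C]
  {F : C ⥤ ElemFrobenioid Φ}

/-- **The zero divisors in a square of Prop. 1.14 (v).** If `α ≫ ψ = φ ≫ α ≫ β` with `φ` a `Div`-identity
prime-Frobenius endomorphism, `α` a step, `ψ` an irreducible non-pre-step and `β` a step, then
`α^* Div(β) · Div(α) = Div(α)^{deg φ}` (Prop. 1.14 (iv) identifies `ψ` as prime-Frobenius of degree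
`deg φ`; Remark 1.1.1). [cite: MochizukiFrdI2008, Thm. 3.4 (iii) p.65] -/
theorem pull_div_mul_of_square (hF : PreFrobenioid.IsFrobenioid F)
    (hi : ∀ A : C, PreFrobenioid.IsIsotropic F A) {A : C} {φ : A ⟶ A} (hdi : PreFrobenioid.IsDivIdentity F φ)
    (hφ : PreFrobenioid.IsPrimeFrobenius F φ) {B B' : C} {α : A ⟶ B} (hα : PreFrobenioid.IsStep F α)
    {ψ β : B ⟶ B'} (hψ : IsIrreducibleHom ψ ∧ ¬ PreFrobenioid.IsPreStep F ψ) (hβ : PreFrobenioid.IsStep F β)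
    (hsq : α ≫ ψ = φ ≫ α ≫ β) :
    pull Φ (PreFrobenioid.Base F α) (PreFrobenioid.Div F β) * PreFrobenioid.Div F α =
      PreFrobenioid.Div F α ^ (PreFrobenioid.degFr F φ : ℕ) := by
  -- `ψ` is prime-Frobenius of degree `deg φ`
  have hdeg1 : PreFrobenioid.degFr F α = PreFrobenioid.degFr F (α ≫ β) := by
    rw [PreFrobenioid.degFr_comp, show PreFrobenioid.degFr F α = 1 from hα.1.1,
      show PreFrobenioid.degFr F β = 1 from hβ.1.1, mul_one]
  obtain ⟨hiff, hd⟩ := PreFrobenioid.isPrimeFrobenius_iff_of_square F hF hi hsq hdeg1 hψ.1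
    (hφ.isIrreducibleHom hF (hi A))
  have hψp : PreFrobenioid.IsPrimeFrobenius F ψ := hiff.2 hφ
  have h := congrArg (PreFrobenioid.Div F) hsq
  rw [PreFrobenioid.div_comp, show PreFrobenioid.Div F ψ = 1 from hψp.1.1.2, map_one, one_mul, hd,
    PreFrobenioid.div_comp, show PreFrobenioid.Div F φ = 1 from hφ.1.1.2, one_pow, mul_one,
    show pull Φ (PreFrobenioid.Base F φ) = MonoidHom.id _ from hdi, MonoidHom.id_apply,
    PreFrobenioid.div_comp, show PreFrobenioid.degFr F β = 1 from hβ.1.1, PNat.one_coe, pow_one] at h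
  exact h.symm

/-- From the squares of Prop. 1.14 (v) for `ζ` and `θ` (same step `α`): if `deg ζ ≤ deg θ` then `β_θ`
factors through `β_ζ` by a co-angular pre-step (Def. 1.3 (iii)(d)). [cite: MochizukiFrdI2008, Thm. 3.4 (iii) p.65] -/
theorem exists_fac_of_degFr_le (hF : PreFrobenioid.IsFrobenioid F)
    (hi : ∀ A : C, PreFrobenioid.IsIsotropic F A) {A : C} {ζ θ : A ⟶ A}
    (hζd : PreFrobenioid.IsDivIdentity F ζ) (hζ : PreFrobenioid.IsPrimeFrobenius F ζ)
    (hθd : PreFrobenioid.IsDivIdentity F θ) (hθ : PreFrobenioid.IsPrimeFrobenius F θ)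
    {B Bζ Bθ : C} {α : A ⟶ B} (hα : PreFrobenioid.IsStep F α) {ψζ βζ : B ⟶ Bζ} {ψθ βθ : B ⟶ Bθ}
    (hψζ : IsIrreducibleHom ψζ ∧ ¬ PreFrobenioid.IsPreStep F ψζ) (hβζ : PreFrobenioid.IsStep F βζ)
    (hsqζ : α ≫ ψζ = ζ ≫ α ≫ βζ)
    (hψθ : IsIrreducibleHom ψθ ∧ ¬ PreFrobenioid.IsPreStep F ψθ) (hβθ : PreFrobenioid.IsStep F βθ)
    (hsqθ : α ≫ ψθ = θ ≫ α ≫ βθ)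
    (hle : (PreFrobenioid.degFr F ζ : ℕ) ≤ (PreFrobenioid.degFr F θ : ℕ)) :
    ∃ γ : Bζ ⟶ Bθ, PreFrobenioid.IsPreStep F γ ∧ βζ ≫ γ = βθ := by
  have hP := hF.isPreFrobenioid
  haveI : IsCancelMul (Φ.obj (op (PreFrobenioid.baseObj F A))) :=
    isIntegral_iff_isCancelMul.1 (hP.isDivisorial _).isPreDivisorial.isIntegral
  have h1 := pull_div_mul_of_square hF hi hζd hζ hα hψζ hβζ hsqζ
  have h2 := pull_div_mul_of_square hF hi hθd hθ hα hψθ hβθ hsqθ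
  -- `α^* Div βθ = Div α ^ (q - p) * α^* Div βζ`
  have h3 : pull Φ (PreFrobenioid.Base F α) (PreFrobenioid.Div F βθ) =
      PreFrobenioid.Div F α ^ ((PreFrobenioid.degFr F θ : ℕ) - (PreFrobenioid.degFr F ζ : ℕ)) *
        pull Φ (PreFrobenioid.Base F α) (PreFrobenioid.Div F βζ) := by
    apply mul_right_cancel (b := PreFrobenioid.Div F α)
    rw [h2, mul_assoc, h1, ← pow_add, Nat.sub_add_cancel hle]
  haveI : IsIso (PreFrobenioid.Base F α) := hα.1.2
  have hdvd : PreFrobenioid.Div F βζ ∣ PreFrobenioid.Div F βθ := by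
    refine ⟨pull Φ (inv (PreFrobenioid.Base F α))
      (PreFrobenioid.Div F α ^ ((PreFrobenioid.degFr F θ : ℕ) - (PreFrobenioid.degFr F ζ : ℕ))), ?_⟩
    apply (hP.isMonoidOn.isCharInjective (PreFrobenioid.Base F α)).1
    rw [h3, map_mul, ← pull_comp, IsIso.hom_inv_id, pull_id, mul_comm]
  obtain ⟨γ, hγ, hfac⟩ := hF.iii_d_under_full βζ βθ
    ⟨PreFrobenioid.isCoAngular_of_isIsotropic_codomains F βζ (fun Z _ => hi Z), hβζ.1⟩
    ⟨PreFrobenioid.isCoAngular_of_isIsotropic_codomains F βθ (fun Z _ => hi Z), hβθ.1⟩ hdvd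
  exact ⟨γ, hγ.2, hfac⟩

/-- A base-identity endomorphism is a `Div`-identity endomorphism. [cite: MochizukiFrdI2008, Def. 1.2 (ii) p.22] -/
theorem isDivIdentity_of_isBaseIdentity {A : C} {φ : A ⟶ A} (h : PreFrobenioid.IsBaseIdentity F φ) :
    PreFrobenioid.IsDivIdentity F φ := by
  change pull Φ (PreFrobenioid.Base F φ) = MonoidHom.id _
  rw [show PreFrobenioid.Base F φ = 𝟙 _ from h]
  exact MonoidHom.ext fun x => pull_id Φ _ x

/-- A Frobenioid with a non-group-like object has a non-group-like Frobenius-trivial object (Def. 1.3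
(i)(a), (b)). [cite: MochizukiFrdI2008, Thm. 3.4 (iii) p.65] -/
theorem exists_frobeniusTrivial_not_isGroupLikeObj (hF : PreFrobenioid.IsFrobenioid F) {N : C}
    (hN : ¬ PreFrobenioid.IsGroupLikeObj F N) :
    ∃ T : C, PreFrobenioid.IsFrobeniusTrivial F T ∧ ¬ PreFrobenioid.IsGroupLikeObj F T := by
  have hP := hF.isPreFrobenioid
  obtain ⟨T, hT, ⟨e⟩⟩ := hF.i_a (PreFrobenioid.baseObj F N)
  obtain ⟨X, φ, ψ, -, hψ, -⟩ := hF.i_b N T e.symm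
  exact ⟨T, hT, fun h => hN (isGroupLikeObj_of_isBaseIso hP φ (isGroupLikeObj_of_isBaseIso' hP ψ hψ.2 h))⟩

end One

section Two

variable {D₁ : Type u} [Category.{v} D₁] {Φ₁ : D₁ᵒᵖ ⥤ CommMonCat.{w}} {C₁ : Type u'}
  [Category.{v'} C₁] {D₂ : Type u} [Category.{v} D₂] {Φ₂ : D₂ᵒᵖ ⥤ CommMonCat.{w}} {C₂ : Type u'}
  [Category.{v'} C₂] {F₁ : C₁ ⥤ ElemFrobenioid Φ₁} {F₂ : C₂ ⥤ ElemFrobenioid Φ₂}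

/-- **(F3), monotonicity.** For `Div`-identity prime-Frobenius endomorphisms `ζ`, `θ` of a non-group-like
object with `deg ζ ≤ deg θ`, the images satisfy `deg Ψζ ≤ deg Ψθ` (isotropic type, bases of FSM-type,
`Φ₂` non-dilating). [cite: MochizukiFrdI2008, Thm. 3.4 (iii) p.65] -/
theorem degFr_map_le (hF₁ : PreFrobenioid.IsFrobenioid F₁) (hF₂ : PreFrobenioid.IsFrobenioid F₂)
    (hi₁ : ∀ A : C₁, PreFrobenioid.IsIsotropic F₁ A) (hi₂ : ∀ A : C₂, PreFrobenioid.IsIsotropic F₂ A)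
    (hD₁ : IsOfFSMType D₁) (hD₂ : IsOfFSMType D₂) (hnd₂ : IsNonDilatingOn Φ₂) (Ψ : C₁ ≌ C₂) {A : C₁}
    (hA : ¬ PreFrobenioid.IsGroupLikeObj F₁ A) {ζ θ : A ⟶ A} (hζd : PreFrobenioid.IsDivIdentity F₁ ζ)
    (hζ : PreFrobenioid.IsPrimeFrobenius F₁ ζ) (hθd : PreFrobenioid.IsDivIdentity F₁ θ)
    (hθ : PreFrobenioid.IsPrimeFrobenius F₁ θ)
    (hle : (PreFrobenioid.degFr F₁ ζ : ℕ) ≤ (PreFrobenioid.degFr F₁ θ : ℕ)) :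
    (PreFrobenioid.degFr F₂ (Ψ.functor.map ζ) : ℕ) ≤ (PreFrobenioid.degFr F₂ (Ψ.functor.map θ) : ℕ) := by
  have hP₁ := hF₁.isPreFrobenioid
  have hP₂ := hF₂.isPreFrobenioid
  -- a step `α : A → B`
  obtain ⟨x, hx⟩ : ∃ x : Φ₁.obj (op (PreFrobenioid.baseObj F₁ A)), x ≠ 1 := by
    by_contra h
    push Not at h
    exact hA h
  obtain ⟨B, α, hαc, hαx⟩ := hF₁.iii_d_under_surj A x
  have hα : PreFrobenioid.IsStep F₁ α := ⟨hαc.2, fun h => hx (by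
    rw [← hαx]; haveI := h; exact PreFrobenioid.isIsometry_of_isIso F₁ hP₁ α)⟩
  -- the squares of Prop. 1.14 (v) for `ζ` and `θ`, and the factorisation `βθ = βζ ≫ γ`
  obtain ⟨Bζ, ψζ, βζ, hψζ, hβζ, hsqζ⟩ :=
    PreFrobenioid.exists_square_of_isDivIdentity_isPrimeFrobenius F₁ hF₁ hi₁ hζd hζ α hα
  obtain ⟨Bθ, ψθ, βθ, hψθ, hβθ, hsqθ⟩ :=
    PreFrobenioid.exists_square_of_isDivIdentity_isPrimeFrobenius F₁ hF₁ hi₁ hθd hθ α hα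
  obtain ⟨γ, hγ, hfac⟩ := exists_fac_of_degFr_le hF₁ hi₁ hζd hζ hθd hθ hα hψζ hβζ hsqζ hψθ hβθ hsqθ hle
  -- everything in `C₂`
  obtain ⟨hΨζd, hΨζ⟩ := isDivIdentity_isPrimeFrobenius_map hF₁ hF₂ hi₁ hi₂ hD₁ hD₂ hnd₂ Ψ hA hζd hζ
  obtain ⟨hΨθd, hΨθ⟩ := isDivIdentity_isPrimeFrobenius_map hF₁ hF₂ hi₁ hi₂ hD₁ hD₂ hnd₂ Ψ hA hθd hθ
  have hΨα := isStep_map_of_isOfFSMType' hF₁ hF₂ hi₁ hi₂ hD₂ Ψ hα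
  have hns : ∀ {X Y : C₁} {ψ : X ⟶ Y}, IsIrreducibleHom ψ ∧ ¬ PreFrobenioid.IsPreStep F₁ ψ →
      IsIrreducibleHom (Ψ.functor.map ψ) ∧ ¬ PreFrobenioid.IsPreStep F₂ (Ψ.functor.map ψ) :=
    fun h => ⟨h.1.map_equivalence Ψ, fun h' => h.2 (isPreStep_of_map_of_isOfFSMType hF₁ hF₂ hi₁ hi₂ hD₁ Ψ h')⟩
  have hsqζ₂ : Ψ.functor.map α ≫ Ψ.functor.map ψζ =
      Ψ.functor.map ζ ≫ Ψ.functor.map α ≫ Ψ.functor.map βζ := by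
    rw [← Functor.map_comp, hsqζ, Functor.map_comp, Functor.map_comp]
  have hsqθ₂ : Ψ.functor.map α ≫ Ψ.functor.map ψθ =
      Ψ.functor.map θ ≫ Ψ.functor.map α ≫ Ψ.functor.map βθ := by
    rw [← Functor.map_comp, hsqθ, Functor.map_comp, Functor.map_comp]
  have h1 := pull_div_mul_of_square hF₂ hi₂ hΨζd hΨζ hΨα (hns hψζ)
    (isStep_map_of_isOfFSMType' hF₁ hF₂ hi₁ hi₂ hD₂ Ψ hβζ) hsqζ₂
  have h2 := pull_div_mul_of_square hF₂ hi₂ hΨθd hΨθ hΨα (hns hψθ)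
    (isStep_map_of_isOfFSMType' hF₁ hF₂ hi₁ hi₂ hD₂ Ψ hβθ) hsqθ₂
  -- `Div Ψβθ = (transported Div Ψγ) * Div Ψβζ`
  have hγ₂ : PreFrobenioid.IsPreStep F₂ (Ψ.functor.map γ) := isPreStep_map_of_isOfFSMType hF₁ hF₂ hi₁ hi₂ hD₂ Ψ hγ
  have h3 : PreFrobenioid.Div F₂ (Ψ.functor.map βθ) =
      pull Φ₂ (PreFrobenioid.Base F₂ (Ψ.functor.map βζ)) (PreFrobenioid.Div F₂ (Ψ.functor.map γ)) *
        PreFrobenioid.Div F₂ (Ψ.functor.map βζ) := by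
    rw [← hfac, Functor.map_comp, PreFrobenioid.div_comp,
      show PreFrobenioid.degFr F₂ (Ψ.functor.map γ) = 1 from hγ₂.1, PNat.one_coe, pow_one]
  haveI : IsCancelMul (Φ₂.obj (op (PreFrobenioid.baseObj F₂ (Ψ.functor.obj A)))) :=
    isIntegral_iff_isCancelMul.1 (hP₂.isDivisorial _).isPreDivisorial.isIntegral
  refine le_of_pow_eq_pow_mul (hP₂.isDivisorial _).isSharp
    (PreFrobenioid.div_ne_one_of_isStep hi₂ hΨα)
    (c := pull Φ₂ (PreFrobenioid.Base F₂ (Ψ.functor.map α))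
      (pull Φ₂ (PreFrobenioid.Base F₂ (Ψ.functor.map βζ)) (PreFrobenioid.Div F₂ (Ψ.functor.map γ)))) ?_
  rw [← h2, ← h1, h3, map_mul]
  simp only [mul_assoc, mul_comm]

/-- The Frobenius degree of `Ψ⁻¹(Ψ f)` is that of `f`. [cite: MochizukiFrdI2008, Thm. 3.4 (iii) p.64] -/
theorem degFr_inv_map_map (Ψ : C₁ ≌ C₂) {A B : C₁} (f : A ⟶ B) :
    PreFrobenioid.degFr F₁ (Ψ.inverse.map (Ψ.functor.map f)) = PreFrobenioid.degFr F₁ f := by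
  rw [Ψ.inv_fun_map, PreFrobenioid.degFr_comp, PreFrobenioid.degFr_comp,
    show PreFrobenioid.degFr F₁ (Ψ.unitInv.app A) = 1 from PreFrobenioid.isLinear_of_isIso F₁ _,
    show PreFrobenioid.degFr F₁ (Ψ.unit.app B) = 1 from PreFrobenioid.isLinear_of_isIso F₁ _, one_mul, mul_one]

/-- **Thm. 3.4 (iii), (F3): `Ψ` preserves the Frobenius degrees of prime-Frobenius morphisms**
(`Ψ^{ℕ≥1} = id`) — Frobenioids of isotropic type over bases of FSM-type, `Φ₁`, `Φ₂` non-dilating,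
non-group-like objects on both sides. Induction on the degree: consistency of `p ↦ p'` for `Ψ` and
`Ψ⁻¹`, and monotonicity. [cite: MochizukiFrdI2008, Thm. 3.4 (iii) p.65] -/
theorem degFr_map_of_isPrimeFrobenius (hF₁ : PreFrobenioid.IsFrobenioid F₁)
    (hF₂ : PreFrobenioid.IsFrobenioid F₂) (hi₁ : ∀ A : C₁, PreFrobenioid.IsIsotropic F₁ A)
    (hi₂ : ∀ A : C₂, PreFrobenioid.IsIsotropic F₂ A) (hD₁ : IsOfFSMType D₁) (hD₂ : IsOfFSMType D₂)
    (hnd₁ : IsNonDilatingOn Φ₁) (hnd₂ : IsNonDilatingOn Φ₂) (Ψ : C₁ ≌ C₂) {N₁ : C₁}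
    (hN₁ : ¬ PreFrobenioid.IsGroupLikeObj F₁ N₁) {N₂ : C₂} (hN₂ : ¬ PreFrobenioid.IsGroupLikeObj F₂ N₂) :
    ∀ (n : ℕ) {A A' : C₁} {f : A ⟶ A'}, PreFrobenioid.IsPrimeFrobenius F₁ f →
      (PreFrobenioid.degFr F₁ f : ℕ) = n → (PreFrobenioid.degFr F₂ (Ψ.functor.map f) : ℕ) = n := by
  obtain ⟨T, ⟨z, hz⟩, hT⟩ := exists_frobeniusTrivial_not_isGroupLikeObj hF₁ hN₁
  obtain ⟨T₂, ⟨z₂, hz₂⟩, hT₂⟩ := exists_frobeniusTrivial_not_isGroupLikeObj hF₂ hN₂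
  -- the base-identity `r`-Frobenius endomorphisms of `T`, `T₂`
  have hzp : ∀ r : ℕ+, (r : ℕ).Prime → PreFrobenioid.IsDivIdentity F₁ (z r) ∧
      PreFrobenioid.IsPrimeFrobenius F₁ (z r) ∧ PreFrobenioid.degFr F₁ (z r) = r := fun r hr =>
    ⟨isDivIdentity_of_isBaseIdentity (hz r).2.1, ⟨(hz r).2.2, by rw [(hz r).1]; exact hr⟩, (hz r).1⟩
  have hz₂p : ∀ r : ℕ+, (r : ℕ).Prime →
      PreFrobenioid.IsPrimeFrobenius F₂ (z₂ r) ∧ PreFrobenioid.degFr F₂ (z₂ r) = r := fun r hr =>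
    ⟨⟨(hz₂ r).2.2, by rw [(hz₂ r).1]; exact hr⟩, (hz₂ r).1⟩
  intro n
  induction n using Nat.strong_induction_on with
  | _ n ih =>
    intro A A' f hf hn
    have hΨf := isPrimeFrobenius_map hF₁ hF₂ hi₁ hi₂ hD₁ hD₂ hnd₂ Ψ hN₁ hf
    set p' : ℕ := (PreFrobenioid.degFr F₂ (Ψ.functor.map f) : ℕ) with hp'def
    have hp' : p'.Prime := hΨf.2
    have hp : n.Prime := by rw [← hn]; exact hf.2
    rcases lt_trichotomy p' n with hlt | heq | hgt
    · -- (a) `p' < n`: the `p'`-Frobenius endomorphism of `T` also maps to degree `p'`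
      exfalso
      obtain ⟨-, hgp, hgd⟩ := hzp ⟨p', hp'.pos⟩ hp'
      have hΨg : (PreFrobenioid.degFr F₂ (Ψ.functor.map (z ⟨p', hp'.pos⟩)) : ℕ) = p' :=
        ih p' hlt hgp (by rw [hgd]; rfl)
      -- consistency for `Ψ⁻¹` on the prime-Frobenius morphisms `Ψ f`, `Ψ g` of equal degree
      have hΨgp := isPrimeFrobenius_map hF₁ hF₂ hi₁ hi₂ hD₁ hD₂ hnd₂ Ψ hN₁ hgp
      have hdeg : PreFrobenioid.degFr F₂ (Ψ.functor.map f) =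
          PreFrobenioid.degFr F₂ (Ψ.functor.map (z ⟨p', hp'.pos⟩)) := PNat.eq (by rw [hΨg])
      have hc := degFr_map_eq_of_degFr_eq hF₂ hF₁ hi₂ hi₁ hD₂ hD₁ hnd₁ Ψ.symm hN₂ hΨf hΨgp hdeg
      change PreFrobenioid.degFr F₁ (Ψ.inverse.map (Ψ.functor.map f)) =
        PreFrobenioid.degFr F₁ (Ψ.inverse.map (Ψ.functor.map _)) at hc
      rw [degFr_inv_map_map, degFr_inv_map_map, hgd] at hc
      have : n = p' := by rw [← hn, hc]; rfl
      exact hlt.ne this.symm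
    · exact heq
    · -- (c) `p' > n`: look at the `n`-Frobenius endomorphism `h` of `T₂` and `ρ := Ψ⁻¹ h`
      exfalso
      obtain ⟨hhp, hhd⟩ := hz₂p ⟨n, hp.pos⟩ hp
      have hρ := isPrimeFrobenius_map hF₂ hF₁ hi₂ hi₁ hD₂ hD₁ hnd₁ Ψ.symm hN₂ hhp
      change PreFrobenioid.IsPrimeFrobenius F₁ (Ψ.inverse.map (z₂ ⟨n, hp.pos⟩)) at hρ
      set r : ℕ := (PreFrobenioid.degFr F₁ (Ψ.inverse.map (z₂ ⟨n, hp.pos⟩)) : ℕ) with hrdef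
      have hr : r.Prime := hρ.2
      -- `deg Ψ ρ = n`
      have hΨρ : (PreFrobenioid.degFr F₂ (Ψ.functor.map (Ψ.inverse.map (z₂ ⟨n, hp.pos⟩))) : ℕ) = n := by
        rw [Ψ.fun_inv_map, PreFrobenioid.degFr_comp, PreFrobenioid.degFr_comp,
          show PreFrobenioid.degFr F₂ (Ψ.counit.app _) = 1 from PreFrobenioid.isLinear_of_isIso F₂ _,
          show PreFrobenioid.degFr F₂ (Ψ.counitInv.app _) = 1 from PreFrobenioid.isLinear_of_isIso F₂ _,
          one_mul, mul_one, hhd]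
        rfl
      rcases lt_trichotomy r n with hrl | hre | hrg
      · -- `r < n`: induction hypothesis
        have := ih r hrl hρ rfl
        rw [hΨρ] at this
        exact hrl.ne this.symm
      · -- `r = n`: consistency for `Ψ`
        have hdeg : PreFrobenioid.degFr F₁ f = PreFrobenioid.degFr F₁ (Ψ.inverse.map (z₂ ⟨n, hp.pos⟩)) :=
          PNat.eq (hn.trans hre.symm)
        have hc := degFr_map_eq_of_degFr_eq hF₁ hF₂ hi₁ hi₂ hD₁ hD₂ hnd₂ Ψ hN₁ hf hρ hdeg
        have : p' = n := by rw [hp'def, hc, hΨρ]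
        exact hgt.ne this.symm
      · -- `r > n`: monotonicity at `T` between the `n`- and `r`-Frobenius endomorphisms
        obtain ⟨hnd', hnp, hndeg⟩ := hzp ⟨n, hp.pos⟩ hp
        obtain ⟨hrd', hrp, hrdeg⟩ := hzp ⟨r, hr.pos⟩ hr
        have hmono := degFr_map_le hF₁ hF₂ hi₁ hi₂ hD₁ hD₂ hnd₂ Ψ hT hnd' hnp hrd' hrp
          (by rw [hndeg, hrdeg]; exact hrg.le)
        -- `deg Ψ(z n) = p'` and `deg Ψ(z r) = n` by consistency
        have hc1 := degFr_map_eq_of_degFr_eq hF₁ hF₂ hi₁ hi₂ hD₁ hD₂ hnd₂ Ψ hN₁ hf hnp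
          (PNat.eq (by rw [hn, hndeg]; rfl))
        have hc2 := degFr_map_eq_of_degFr_eq hF₁ hF₂ hi₁ hi₂ hD₁ hD₂ hnd₂ Ψ hN₁ hρ hrp
          (PNat.eq (by rw [hrdeg]; rfl))
        rw [← hc1, ← hc2] at hmono
        have : p' ≤ n := by rw [hp'def, ← hΨρ]; exact hmono
        exact absurd hgt (not_lt.2 this)

end Two

end FrdI

end Literature.AlgebraicGeometry.Frobenioids
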